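import Summits.ValiantsHypothesis.ValiantsHypothesis.Theorems.KPlusLogSqLawTropicalBToeplitzConjectureT

/-!
# Route `KPlusLogSqLaw`, crux `TropicalB` — Toeplitz sector: the upper-hull vertex set of the lifted weight graph changes `O(m)` times along a line (the «number of regimes» lemma F1)

HONEST FRAMING.  Helper toward the registered stubs `stub_tropThin` / `stub_tropFat` of
`Cruxes/TropicalB/Lines/birth.lean` (crux `Summit.ValiantsHypothesis.ValiantsHypothesis.Theses.KPlusLogSqLaw.TropicalB`,
ledger item `stmt-ValiantsHypothesis-19771`, route `KPlusLogSqLaw`; cell `pub-symmetroid`, seat `val-sym-trop-p3`,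
2026-08-26).  Structure lemma for the cell's OPEN Conjecture T on linear Toeplitz instances `(ψ, α, P)` (method memo
CONJT-METHOD-g22 §3.4 (F1), «provable now»; desk ruling R1522 «next rung»): along the line `θ ↦ w_θ = θ·ψ + α` the REGIME of a
slope — the pair of displacement classes the Lagrangian relaxation saturates, i.e. the edge of the UPPER CONVEX HULL of the
lifted weight graph `{(δ, w_θ(δ)) : δ ∈ D}` straddling `δ = 0` (`…ToeplitzTwoPhase`, `…ToeplitzUnitRegime`) — is a function of the
hull's VERTEX SET, and this file proves that the vertex set changes at most `2·|D|` times along any monotone slope sequence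
(indeed at most twice per site that is not a permanent vertex; for `D = [−(m−1), m−1]` the two endpoints are permanent, giving
`≤ 4m − 6` changes, i.e. at most `4m − 5` maximal runs of constant vertex set / regime).  Nothing here counts optima; nothing
bears on `TropicalB` for general designs, `KPlusLogSqLaw`, `MatrixDescartes` or `VP ≠ VNP`.

THE RESULTS.
* `card_changes_le_two` — a predicate on `Fin (N+1)` with the INTERVAL property (`i ≤ j ≤ l`, `f i`, `f l ⇒ f j`) changes
  truth value at no more than two consecutive pairs (the value before a change determines the change).
* `hullVertex_interval` — for a site `δ` and sites `D`, «`δ` is a STRICT VERTEX of the upper hull of `{(δ', θ ψ δ' + α δ')}_{δ' ∈ D}`»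
  (strictly above every chord `a < δ < b`, `a, b ∈ D`) holds on an INTERVAL of slopes `θ`: each chord condition is affine in `θ`.
* `card_hullVertexChanges_le` — hence along a monotone slope sequence `θ'_0 ≤ … ≤ θ'_N` the number of indices `k` at which the
  vertex set differs between `θ'_k` and `θ'_{k+1}` is at most `2·#{δ ∈ D : δ is not a vertex at every θ'_k}` (`≤ 2·|D|`,
  `card_hullVertexChanges_le_two_mul_card`).
* `card_hullVertexChanges_displacements_le` — for the displacement range `D = [−(m−1), m−1]` of size-`m` permutations (as a
  hypothesis `hD`, apply with `rfl`) the two endpoints are permanent vertices: at most `2·(2m − 3)` changes.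

References: folklore (upper envelopes of pencils of point configurations; parametric convex hulls).
-/

set_option linter.dupNamespace false
set_option autoImplicit false

namespace Summit.ValiantsHypothesis.ValiantsHypothesis.Theorems.KPlusLogSqLaw.Toeplitz

open scoped BigOperators
open Finset

section IntervalPredicates

/-- **A predicate with the interval property changes at most twice** along `Fin (N+1)`: the set of `k : Fin N` with
`f k.castSucc ↔ f k.succ` failing has at most two elements (the value of `f` before a change determines the change point).
[folklore] -/
theorem card_changes_le_two {N : ℕ} (f : Fin (N + 1) → Prop) [DecidablePred f]
    (hconv : ∀ i j l : Fin (N + 1), i ≤ j → j ≤ l → f i → f l → f j) :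
    (univ.filter fun k : Fin N => ¬ (f k.castSucc ↔ f k.succ)).card ≤ 2 := by
  classical
  -- the value before the change is injective on change points
  have key : ∀ k k' : Fin N, k < k' → ¬ (f k.castSucc ↔ f k.succ) → ¬ (f k'.castSucc ↔ f k'.succ) →
      (f k.castSucc ↔ f k'.castSucc) → False := by
    intro k k' hkk' hk hk' hiff
    have hle1 : k.succ ≤ k'.castSucc := by
      rw [Fin.le_def, Fin.val_succ, Fin.val_castSucc]; exact hkk'
    have hle2 : k'.castSucc ≤ k'.succ := by
      rw [Fin.le_def, Fin.val_succ, Fin.val_castSucc]; exact Nat.le_succ _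
    have hle0 : k.castSucc ≤ k.succ := by
      rw [Fin.le_def, Fin.val_succ, Fin.val_castSucc]; exact Nat.le_succ _
    by_cases hfk : f k.castSucc
    · -- `f` drops at `k`, is true again at `k'.castSucc`: interval property violated at `k.succ`
      have hks : ¬ f k.succ := fun h => hk ⟨fun _ => h, fun _ => hfk⟩
      have hk's : f k'.castSucc := hiff.mp hfk
      exact hks (hconv k.castSucc k.succ k'.castSucc hle0 hle1 hfk hk's)
    · -- `f` rises at `k` (true at `k.succ`), is false at `k'.castSucc` and true at `k'.succ`: violated at `k'.castSucc`
      have hks : f k.succ := by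
        by_contra h; exact hk ⟨fun h' => absurd h' hfk, fun h' => absurd h' h⟩
      have hk'c : ¬ f k'.castSucc := fun h => hfk (hiff.mpr h)
      have hk's : f k'.succ := by
        by_contra h; exact hk' ⟨fun h' => absurd h' hk'c, fun h' => absurd h' h⟩
      exact hk'c (hconv k.succ k'.castSucc k'.succ hle1 hle2 hks hk's)
  have hinj : Set.InjOn (fun k : Fin N => decide (f k.castSucc))
      ↑(univ.filter fun k : Fin N => ¬ (f k.castSucc ↔ f k.succ)) := by
    intro k hk k' hk' hkk'
    simp only [coe_filter, mem_univ, true_and, Set.mem_setOf_eq] at hk hk'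
    have hiff : f k.castSucc ↔ f k'.castSucc := by
      simpa only [decide_eq_decide] using hkk'
    by_contra hne
    rcases lt_or_gt_of_ne hne with h | h
    · exact key k k' h hk hk' hiff
    · exact key k' k h hk' hk hiff.symm
  calc (univ.filter fun k : Fin N => ¬ (f k.castSucc ↔ f k.succ)).card
      ≤ (univ : Finset Bool).card := card_le_card_of_injOn _ (fun _ _ => mem_univ _) hinj
    _ = 2 := by simp

end IntervalPredicates

section Hull

/-- **Hull vertices persist on slope intervals.**  «`δ` is a strict vertex of the upper hull of the lifted weight graph
`{(δ', θ ψ δ' + α δ')}_{δ' ∈ D}`» — `δ` strictly above every chord `a < δ < b` with `a, b ∈ D` — is, for fixed `δ`, a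
convex condition in `θ` (each chord inequality is affine in `θ`). [folklore] -/
theorem hullVertex_interval (ψ α : ℤ → ℤ) (D : Finset ℤ) (δ : ℤ) {θ₁ θ₂ θ₃ : ℤ} (h12 : θ₁ ≤ θ₂) (h23 : θ₂ ≤ θ₃)
    (h1 : ∀ a ∈ D, ∀ b ∈ D, a < δ → δ < b →
      (b - δ) * (θ₁ * ψ a + α a) + (δ - a) * (θ₁ * ψ b + α b) < (b - a) * (θ₁ * ψ δ + α δ))
    (h3 : ∀ a ∈ D, ∀ b ∈ D, a < δ → δ < b →
      (b - δ) * (θ₃ * ψ a + α a) + (δ - a) * (θ₃ * ψ b + α b) < (b - a) * (θ₃ * ψ δ + α δ)) :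
    ∀ a ∈ D, ∀ b ∈ D, a < δ → δ < b →
      (b - δ) * (θ₂ * ψ a + α a) + (δ - a) * (θ₂ * ψ b + α b) < (b - a) * (θ₂ * ψ δ + α δ) := by
  intro a ha b hb had hdb
  have g1 := h1 a ha b hb had hdb
  have g3 := h3 a ha b hb had hdb
  -- the chord defect is affine in `θ`: `g(θ₂)·(θ₃ − θ₁) = g(θ₁)·(θ₃ − θ₂) + g(θ₃)·(θ₂ − θ₁)`
  have key : ((b - a) * (θ₂ * ψ δ + α δ) - ((b - δ) * (θ₂ * ψ a + α a) + (δ - a) * (θ₂ * ψ b + α b))) * (θ₃ - θ₁) =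
      ((b - a) * (θ₁ * ψ δ + α δ) - ((b - δ) * (θ₁ * ψ a + α a) + (δ - a) * (θ₁ * ψ b + α b))) * (θ₃ - θ₂) +
      ((b - a) * (θ₃ * ψ δ + α δ) - ((b - δ) * (θ₃ * ψ a + α a) + (δ - a) * (θ₃ * ψ b + α b))) * (θ₂ - θ₁) := by
    ring
  rcases eq_or_lt_of_le (h12.trans h23) with h13 | h13
  · -- degenerate interval
    have e : θ₂ = θ₁ := le_antisymm (h13 ▸ h23) h12
    rw [e]; exact g1
  · by_contra hh
    push Not at hh
    have hA : 0 ≤ ((b - a) * (θ₁ * ψ δ + α δ) - ((b - δ) * (θ₁ * ψ a + α a) + (δ - a) * (θ₁ * ψ b + α b))) * (θ₃ - θ₂) :=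
      mul_nonneg (by linarith) (by linarith)
    have hB : 0 ≤ ((b - a) * (θ₃ * ψ δ + α δ) - ((b - δ) * (θ₃ * ψ a + α a) + (δ - a) * (θ₃ * ψ b + α b))) * (θ₂ - θ₁) :=
      mul_nonneg (by linarith) (by linarith)
    have hC : ((b - a) * (θ₂ * ψ δ + α δ) - ((b - δ) * (θ₂ * ψ a + α a) + (δ - a) * (θ₂ * ψ b + α b))) * (θ₃ - θ₁) ≤ 0 :=
      mul_nonpos_of_nonpos_of_nonneg (by linarith) (by linarith)
    -- at least one of the two weights is positive
    rcases lt_or_ge θ₁ θ₂ with h | h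
    · have hB' : 0 < ((b - a) * (θ₃ * ψ δ + α δ) - ((b - δ) * (θ₃ * ψ a + α a) + (δ - a) * (θ₃ * ψ b + α b))) * (θ₂ - θ₁) :=
        mul_pos (by linarith) (by linarith)
      linarith
    · have e : θ₂ = θ₁ := le_antisymm h h12
      have hA' : 0 < ((b - a) * (θ₁ * ψ δ + α δ) - ((b - δ) * (θ₁ * ψ a + α a) + (δ - a) * (θ₁ * ψ b + α b))) * (θ₃ - θ₂) :=
        mul_pos (by linarith) (by rw [e]; linarith)
      linarith

open Classical in
/-- **The vertex set of the upper hull changes at most twice per non-permanent site.**  Along a monotone slope sequence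
`θ'_0 ≤ … ≤ θ'_N`, the number of indices `k < N` at which SOME site of `D` enters or leaves the vertex set of the upper hull of
the lifted weight graph is at most `2·#{δ ∈ D : δ is not a vertex at every θ'_k}`. [folklore] -/
theorem card_hullVertexChanges_le (ψ α : ℤ → ℤ) (D : Finset ℤ) {N : ℕ} (θ' : Fin (N + 1) → ℤ) (hθ : Monotone θ') :
    (univ.filter fun k : Fin N => ∃ δ ∈ D,
      ¬ ((∀ a ∈ D, ∀ b ∈ D, a < δ → δ < b →
            (b - δ) * (θ' k.castSucc * ψ a + α a) + (δ - a) * (θ' k.castSucc * ψ b + α b) <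
              (b - a) * (θ' k.castSucc * ψ δ + α δ)) ↔
          (∀ a ∈ D, ∀ b ∈ D, a < δ → δ < b →
            (b - δ) * (θ' k.succ * ψ a + α a) + (δ - a) * (θ' k.succ * ψ b + α b) <
              (b - a) * (θ' k.succ * ψ δ + α δ)))).card ≤
      2 * (D.filter fun δ => ∃ k : Fin (N + 1), ¬ (∀ a ∈ D, ∀ b ∈ D, a < δ → δ < b →
            (b - δ) * (θ' k * ψ a + α a) + (δ - a) * (θ' k * ψ b + α b) < (b - a) * (θ' k * ψ δ + α δ))).card := by
  -- abbreviations
  set V : Fin (N + 1) → ℤ → Prop := fun k δ => ∀ a ∈ D, ∀ b ∈ D, a < δ → δ < b →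
      (b - δ) * (θ' k * ψ a + α a) + (δ - a) * (θ' k * ψ b + α b) < (b - a) * (θ' k * ψ δ + α δ) with hV
  set D' := D.filter fun δ => ∃ k : Fin (N + 1), ¬ V k δ with hD'
  -- each site's change set has at most two elements
  have hδ : ∀ δ : ℤ, (univ.filter fun k : Fin N => ¬ (V k.castSucc δ ↔ V k.succ δ)).card ≤ 2 := by
    intro δ
    refine card_changes_le_two (fun k => V k δ) fun i j l hij hjl hi hl => ?_
    exact hullVertex_interval ψ α D δ (hθ hij) (hθ hjl) hi hl
  -- the global change set is covered by the sites that are not permanent vertices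
  have hcover : (univ.filter fun k : Fin N => ∃ δ ∈ D, ¬ (V k.castSucc δ ↔ V k.succ δ)) ⊆
      D'.biUnion fun δ => univ.filter fun k : Fin N => ¬ (V k.castSucc δ ↔ V k.succ δ) := by
    intro k hk
    simp only [mem_filter, mem_univ, true_and] at hk
    obtain ⟨δ, hδD, hch⟩ := hk
    rw [mem_biUnion]
    refine ⟨δ, ?_, by simpa using hch⟩
    rw [hD', mem_filter]
    refine ⟨hδD, ?_⟩
    by_contra hall
    push Not at hall
    exact hch ⟨fun _ => hall _, fun _ => hall _⟩
  calc (univ.filter fun k : Fin N => ∃ δ ∈ D, ¬ (V k.castSucc δ ↔ V k.succ δ)).card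
      ≤ (D'.biUnion fun δ => univ.filter fun k : Fin N => ¬ (V k.castSucc δ ↔ V k.succ δ)).card := card_le_card hcover
    _ ≤ ∑ δ ∈ D', (univ.filter fun k : Fin N => ¬ (V k.castSucc δ ↔ V k.succ δ)).card := card_biUnion_le
    _ ≤ ∑ _δ ∈ D', 2 := sum_le_sum fun δ _ => hδ δ
    _ = 2 * D'.card := by rw [sum_const, smul_eq_mul, mul_comm]

open Classical in
/-- coarse form: at most `2·|D|` changes of the vertex set along a monotone slope sequence. [folklore] -/
theorem card_hullVertexChanges_le_two_mul_card (ψ α : ℤ → ℤ) (D : Finset ℤ) {N : ℕ} (θ' : Fin (N + 1) → ℤ)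
    (hθ : Monotone θ') :
    (univ.filter fun k : Fin N => ∃ δ ∈ D,
      ¬ ((∀ a ∈ D, ∀ b ∈ D, a < δ → δ < b →
            (b - δ) * (θ' k.castSucc * ψ a + α a) + (δ - a) * (θ' k.castSucc * ψ b + α b) <
              (b - a) * (θ' k.castSucc * ψ δ + α δ)) ↔
          (∀ a ∈ D, ∀ b ∈ D, a < δ → δ < b →
            (b - δ) * (θ' k.succ * ψ a + α a) + (δ - a) * (θ' k.succ * ψ b + α b) <
              (b - a) * (θ' k.succ * ψ δ + α δ)))).card ≤ 2 * D.card :=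
  (card_hullVertexChanges_le ψ α D θ' hθ).trans (Nat.mul_le_mul_left 2 (card_filter_le _ _))

open Classical in
/-- **Displacement range of size-`m` permutations** (`D = [−(m−1), m−1]`, taken as a hypothesis `hD` so that the statement
elaborates exactly like `card_hullVertexChanges_le`; apply with `rfl`): the two endpoints are permanent vertices (no chord
passes over them), so the vertex set — hence the straddling regime of `…ToeplitzTwoPhase` / `…UnitRegime` — changes at most
`2·(2m − 3)` times along any monotone slope sequence: at most `4m − 5` regimes along a line. [folklore] -/
theorem card_hullVertexChanges_displacements_le (ψ α : ℤ → ℤ) (m : ℕ) (D : Finset ℤ)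
    (hD : D = Icc (-(m : ℤ) + 1) (m - 1)) {N : ℕ} (θ' : Fin (N + 1) → ℤ) (hθ : Monotone θ') :
    (univ.filter fun k : Fin N => ∃ δ ∈ D,
      ¬ ((∀ a ∈ D, ∀ b ∈ D, a < δ → δ < b →
            (b - δ) * (θ' k.castSucc * ψ a + α a) + (δ - a) * (θ' k.castSucc * ψ b + α b) <
              (b - a) * (θ' k.castSucc * ψ δ + α δ)) ↔
          (∀ a ∈ D, ∀ b ∈ D, a < δ → δ < b →
            (b - δ) * (θ' k.succ * ψ a + α a) + (δ - a) * (θ' k.succ * ψ b + α b) <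
              (b - a) * (θ' k.succ * ψ δ + α δ)))).card ≤ 2 * (2 * m - 3) := by
  refine (card_hullVertexChanges_le ψ α D θ' hθ).trans (Nat.mul_le_mul_left 2 ?_)
  -- the non-permanent sites lie strictly inside the range
  calc (Finset.filter _ D).card ≤ (Icc (-(m : ℤ) + 2) (m - 2)).card := by
        refine card_le_card fun δ hδ => ?_
        rw [mem_filter] at hδ
        obtain ⟨hδD, k, hk⟩ := hδ
        rw [hD, mem_Icc] at hδD
        rw [mem_Icc]
        by_contra hout
        apply hk
        intro a ha b hb had hdb
        rw [hD, mem_Icc] at ha hb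
        exfalso
        omega
    _ ≤ 2 * m - 3 := by
        rw [Int.card_Icc, Int.toNat_le]
        omega

end Hull

end Summit.ValiantsHypothesis.ValiantsHypothesis.Theorems.KPlusLogSqLaw.Toeplitz
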